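import Mathlib
import Literature.MathematicalPhysics.QuantumFieldTheory.Balaban1983to89.B12ContourAverage253

/-!
# `Balaban1983to89.B12SmallFieldRegion255` — [Balaban1987RG1] p. 255, the sentence after (0.16): «The new
# restrictions on U(y, x) together with the previously discussed restrictions determine finally a small field
# region in the following sense: fix a configuration U₀ in this region, then configurations U from this region
# satisfy |U − U₀| < O(1)ε₀ on T, with an absolute constant O(1).» — PROVED, bond by bond, on the b12 lineage's
# `ℤᵈ` corner-cube geometry, for the averaged contour variables (0.11) `B12ContourAverage253.Tavg` and the average
# (0.12) `B12AverageCorridor267.avgM`, with the cell's explicit constant `O(1) = 128·(dL)³`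

HONEST FRAMING (cell `lit-balaban`, verbatim): statement-level skeleton of published theorems with citation tags;
proofs where landed; nothing here is a claim about the Yang–Mills mass gap.

CITATION HEADER.  T. Bałaban, *Renormalization group approach to lattice gauge field theories. I. Generation of
effective actions in a small field approximation and a coupling constant renormalization in four dimensions*,
Commun. Math. Phys. **109** (1987) 249–301, doi:10.1007/bf01215223 [Balaban1987RG1] (cell paper B12).  PDF held:
`paper:balaban1987-cmp109-rg-i-small-field` (journal page = PDF page + 248); pp. 254–255 [PDF 6–7] re-read this
generation from the held text AND from the render
`pub-balaban/b2b-balaban-ref1/pages/1987-cmp109-rg-I-small-field/1987-cmp109-rg-I-small-field-p007-x2.png` (read as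
an image: the sentence quoted in the title, (0.16), (0.17)).  [B7] = [Balaban1985Averaging] T. Bałaban, *Averaging
operations for lattice gauge theories*, Commun. Math. Phys. **98** (1985) 17–51, pp. 24–25 (the axial gauge and its
bond bound) — only through the tree modules `B7Prop1Explicit` / `B8Lemma1NonAbelian` (nothing of [B7] re-quoted).
Unit `lit-balaban-r09` gen 9 (display owner of CMP 109; TAKING line `HOME/STATUS.md` 2026-08-21T06:57Z, re-posted 07:11:29Z), HOME
`run/shared/lean/pub/lit-balaban/`; SKELETON row `B12.Eq0.16` (reader cell: «the sentence "|U − U₀| < O(1)ε₀" is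
not a decl»; `B12RTGaugeInvariance254` header: «NOT PROVED HERE … the sentence p. 255»).

WHAT IS PRINTED (verbatim).  p. 254 [PDF 6]: *«We are interested in functions restricted to small field regions,
which in this case means that the function ρ and the integral in (0.13) are restricted to regular configurations U,
i.e. configurations satisfying bounds |U(∂p) − 1| < ε₀, p ∈ T, with ε₀ positive and sufficiently small, and we
consider Tρ on configurations V satisfying similar bounds on T⁽¹⁾. The kernel t(V, U) introduces connections
between fields U and V, like the equalities Ū = V in the definitions of [9,16], or more generally |Ū − V| < ε₀ on
bonds of T⁽¹⁾.»* … *«We use the variables U(y, x) defined in (0.11).»*  p. 255 [PDF 7], (0.16): *«(Tρ)(V) =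
∫dU t(V,U) Π_{y∈T⁽¹⁾} Π_{x∈B(y),x≠y} (1/z) exp[−(1/α)[1 − Re tr U(y,x)]] × χ({|U(y,x) − 1| < ε₀}) ρ(U).»* and the
sentence of the title, followed by *«In concrete situations considered in this paper there is a natural choice of
the configuration U₀ as a minimal configuration of an action.»*

DICTIONARY print → Lean (all objects PRE-EXISTING in the b12 lineage; this file re-declares nothing).  Fine lattice
`T` ↦ `ℤᵈ`, positively oriented bonds `ZdEdge d = (Fin d → ℤ) × Fin d` (`(x, μ) = ⟨x, x + e_μ⟩`); coarse lattice
`T⁽¹⁾` ↦ `ℤᵈ` again, `y ↦ B(y) = L·y + {0,…,L−1}ᵈ` (`blockSites L y`, base point `blockBase L y = L·y` for print's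
`y ∈ B(y)`; corner cubes, lineage DIVERGENCE D-b12g20.1), coarse bonds `c = (y, μ) : ZdEdge d`; `G`-valued ↦ values
in `U1 𝔸 = {u ∈ 𝔸ˣ : ‖u‖ ≤ 1, ‖u⁻¹‖ ≤ 1}` of a complete normed `ℂ`-algebra `𝔸` with `‖1‖ = 1` (contains `U(N) ⊂
M_N(ℂ)`); `|U(∂p) − 1| < ε₀` ↦ `‖plaquetteHolonomyZd U p i j − 1‖ ≤ ε₀` (weak); the averaged contour variable (0.11)
`U(y,x) = M({U(Γ)}_{Γ∈𝐆(y,x)})` ↦ `B12ContourAverage253.Tavg L U x` (Federbush's mean (0.10)); the average (0.12)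
`Ū(c)` ↦ `avgBar L U c := B12AverageCorridor267.avgM L (Tavg L) U c`; «|Ū − V| < ε₀ on bonds of T⁽¹⁾» ↦
`‖avgBar L U c − V c‖ ≤ ε₀` for all `c` (the `δ`-function case `Ū = V` included: `mem_smallFieldRegion_of_avgBar_eq`);
the «small field region» ↦ `smallFieldRegion L ε₀ V : Set (ZdEdge d → 𝔸ˣ)` (the three restrictions); «|U − U₀| <
O(1)ε₀ on T» ↦ `∀ b, ‖U b − U₀ b‖ ≤ 128·(dL)³·ε₀`.

THE ARGUMENT FORMALISED (print gives none; three steps, every input a tree theorem BY NAME).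
(i) INSIDE A BLOCK (§ 3): the (0.16) restriction `‖𝐔(q,x) − 1‖ ≤ ε₀` and the lineage's small-diameter theorem
`‖𝐔(q,x)U(Γ_{q,x})⁻¹ − 1‖ ≤ 4(dL)²ε₀` (`B12ContourAverage253.norm_Tavg_mul_gammaT_inv_sub_one_le`, from plaquette
regularity) put every tree contour `U(Γ_{q,x})`, `x ∈ B(y)`, within `(4(dL)²+1)ε₀` of `1`; the axial gauge of [B7]
p. 24 based at `q` (`B7Prop1Explicit.axialFn`, bond bound `axial_bond_bound` = the non-abelian Stokes ladder,
`‖U₀(b) − 1‖ ≤ |b₋ − q|₁ε₀`) then gives `‖U(b) − 1‖ ≤ (dL + 2(4(dL)²+1))ε₀ ≤ 11(dL)²ε₀` for every bond `b` with both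
endpoints in `B(y)` (`norm_inBlock_sub_one_le`, `norm_sub_one_le_of_mem_inBlock`).
(ii) THE AXIS BOND OF A COARSE BOND (§ 4): `Ū(c) = exp[Y(c)]·U([L c₋, L c₋ + (L−1)e_μ])·U(b₀(c))` (`avgBar_eq`; the
axis loops of (0.12) are `1`, `B12AverageCorridor267.loopW_axisSite`), `‖Y(c)‖ ≤ 2ω_A` for the off-axis loop bound
`ω_A = 10(dL)²ε₀` (`B12ContourAverage253.norm_loopW_Tavg_sub_one_le`, `B12AverageCorridor267.norm_Yexp_le`), the
straight piece is a product of `L − 1` in-block bonds, so `‖U(b₀(c)) − V(c)‖ ≤ ε₀ + (12/5)ω_A + (5/4)(L−1)·11(dL)²ε₀`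
(`norm_axisBond_sub_le`).
(iii) EVERY OTHER CROSSING BOND (§ 5): for `x ∈ B(y)`, `x + e_μ ∉ B(y)`, the ladder `Γ_{a,x} ∪ [x, x+e_μ] ∪
(−(Γ_{a,x} + e_μ)) ∪ [a + e_μ, a]`, `a = b₀(c)₋`, has holonomy within `|x − a|₁ε₀` of `1`
(`B7Prop1Explicit.ladder_bound`, non-abelian Stokes) and long sides made of in-block bonds of `B(y)`, `B(y + e_μ)`
(`B12ContourAverage253.forward_walk`), whence `‖U(x, x+e_μ) − U(b₀(c))‖ ≤ dL(ε₀ + 22(dL)²ε₀)`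
(`norm_crossing_sub_axisBond_le`); with (ii): `‖U(b) − V(c)‖ ≤ 62(dL)³ε₀` (`norm_sub_coarse_le_of_mem_crossing`).
Two configurations of the same region are compared through `1` (in-block bonds) or through `V(c)` (crossing
bonds): **`norm_sub_le_of_mem_smallFieldRegion`**, `‖U(b) − U₀(b)‖ ≤ 128(dL)³ε₀` for every bond `b` of `ℤᵈ`, under
`(dL)²ε₀ ≤ 1/100`, `d ≥ 1`, `L ≥ 1`.  NON-VACUITY (§ 7): the flat configuration lies in the region of `V ≡ 1` for
every `ε₀ ≥ 0` (`one_mem_smallFieldRegion`).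

WHAT IS PROVED (kernel-checked, no `sorry`, axioms `propext`, `Classical.choice`, `Quot.sound`; definitions with
bodies: `avgBar` (the (0.12) average over the (0.11) variables, an abbreviation of lineage objects) and
`smallFieldRegion` (the printed notion); everything else theorems; NO `Prop` placeholder, net new unproved facts 0).

DIVERGENCES FROM PRINT / WHAT IS NOT PROVED (honest scope).  (a) GEOMETRY: `ℤᵈ` with corner cubes and the
lineage's realisation of (0.10)–(0.12) (`B12ContourAverage253` DIVERGENCE D-b12g23.1 (a)–(f) inherited verbatim:
all `d!` axis orderings, Federbush's mean via the tree's local solution `fedSol`, `𝐔(x′, c₊) = 𝐔(c₊, x′)⁻¹`), not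
the torus `T_ε` with centred cubes; weak inequalities for print's strict ones.  (b) THE CONSTANT: print says «an
absolute constant O(1)»; the constant proved here, `128·(dL)³`, depends on the dimension `d` and on the scale
factor `L` (a parameter fixed once for the whole construction, p. 251 «L is a positive odd integer … L > 11»); the
proof route (plaquette-level Stokes estimates inside blocks of side `L`) cannot give an `L`-independent constant,
and whether print's `O(1)` is meant uniformly in `L` is not decided here.  (c) SMALLNESS «ε₀ positive and
sufficiently small» ↦ the single explicit threshold `(dL)²ε₀ ≤ 1/100` (the lineage's, needed for Federbush's mean
and the logarithms of (0.12)).  (d) NOT TOUCHED: the Faddeev–Popov identity (0.16) itself (tree: `B12FaddeevPopov016`,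
`…TwoLevel`), the choice «U₀ as a minimal configuration of an action» (tree: `Setup.IsBackground`, [15]), gauge
covariance (tree: `B12RTGaugeInvariance254`), anything about the torus or about `Gᶜ`-valued configurations.
-/

noncomputable section

open NormedSpace Finset

namespace Literature.MathematicalPhysics.QuantumFieldTheory.Balaban1983to89.B12SmallFieldRegion255

open Literature.MathematicalPhysics.QuantumLattice (ZdEdge blockMap blockBase blockSites mem_blockSites_iff
  plaquetteHolonomyZd)
open B7Eq61Linearization (lineR pathProd pathProd_zero pathProd_succ)
open B7Prop1Explicit (Letter e seg seg_zero hol hol_nil hol_cons stepHol stepHol_true treeWord treeWord_zero disp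
  disp_treeWord length_treeWord gaugeAct axialFn U1 mem_U1 hol_mem gaugeAct_mem axialFn_mem norm_inv_sub_one_le
  norm_units_conj_sub_one_le norm_units_inv_conj_sub_one_le l1 boxVec l1_boxVec_le plaqWord ladder hol_ladder
  ladder_bound norm_hol_lplaqWord_sub_one_le axial_bond_bound mem_seg)
open B8Lemma1NonAbelian (tw treeWord_eq_tw boxVec_nonneg e_nonneg norm_triple_sub_one_le)
open B8Ineq170 (norm_mul_sub_one_le_of_norm_le_one)
open B12HOperator267 (gammaT gcorner axisSite)
open B12AverageCorridor267 (Ustr Ustr_eq_gcorner_mul loopW loopW_axisSite avgM expU val_expU offAxis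
  sum_blockSites_eq Yexp norm_Yexp_le bounds_of_mem_blockSites mem_blockSites_of_bounds)
open B12PlaquetteLoop267 (zsmul_e exists_boxVec gammaT_eq_hol_treeWord hol_curry_plaqWord)
open B12ContourAverage253 (forward_of_mem_tw forward_walk Tavg isAxisStraightFamily_Tavg
  norm_Tavg_mul_gammaT_inv_sub_one_le omegaA omegaA_nonneg norm_loopW_Tavg_sub_one_le)
open B13CorridorSeparation (b0Z)
open MatrixLog (mlog mlog_one)

variable {d : ℕ}

/-! ## § 1  Elementary estimates in the closed unit ball of a normed ring [folklore] -/

section Elementary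

variable {𝔸 : Type*} [NormedRing 𝔸]

/-- [folklore] `‖G − 1‖ ≤ ‖T − 1‖ + ‖T G⁻¹ − 1‖` for a unit `G` of norm `≤ 1` and any `T`
(`G − 1 = (T − 1) − (T G⁻¹ − 1)·G`). -/
private theorem norm_sub_one_le_of_rel {G : 𝔸ˣ} (hG : ‖(G : 𝔸)‖ ≤ 1) (T : 𝔸) :
    ‖(G : 𝔸) - 1‖ ≤ ‖T - 1‖ + ‖T * ((G⁻¹ : 𝔸ˣ) : 𝔸) - 1‖ := by
  have h : (G : 𝔸) - 1 = (T - 1) - (T * ((G⁻¹ : 𝔸ˣ) : 𝔸) - 1) * (G : 𝔸) := by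
    rw [sub_mul, one_mul, mul_assoc, Units.inv_mul, mul_one]; abel
  rw [h]
  calc ‖(T - 1) - (T * ((G⁻¹ : 𝔸ˣ) : 𝔸) - 1) * (G : 𝔸)‖
      ≤ ‖T - 1‖ + ‖(T * ((G⁻¹ : 𝔸ˣ) : 𝔸) - 1) * (G : 𝔸)‖ := norm_sub_le _ _
    _ ≤ ‖T - 1‖ + ‖T * ((G⁻¹ : 𝔸ˣ) : 𝔸) - 1‖ * ‖(G : 𝔸)‖ := by gcongr; exact norm_mul_le _ _
    _ ≤ ‖T - 1‖ + ‖T * ((G⁻¹ : 𝔸ˣ) : 𝔸) - 1‖ * 1 := by gcongr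
    _ = _ := by rw [mul_one]

/-- [folklore] `‖P Λ Z Q − Z‖ ≤ ‖P − 1‖ + ‖Λ − 1‖ + ‖Q − 1‖` when `‖Λ Z Q‖, ‖Z Q‖, ‖Z‖ ≤ 1`. -/
private theorem norm_four_sub_mid_le {P Λ Z Q : 𝔸} (hΛZQ : ‖Λ * Z * Q‖ ≤ 1) (hZQ : ‖Z * Q‖ ≤ 1) (hZ : ‖Z‖ ≤ 1) :
    ‖P * Λ * Z * Q - Z‖ ≤ ‖P - 1‖ + ‖Λ - 1‖ + ‖Q - 1‖ := by
  have h : P * Λ * Z * Q - Z = (P - 1) * (Λ * Z * Q) + (Λ - 1) * (Z * Q) + Z * (Q - 1) := by noncomm_ring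
  rw [h]
  calc ‖(P - 1) * (Λ * Z * Q) + (Λ - 1) * (Z * Q) + Z * (Q - 1)‖
      ≤ ‖(P - 1) * (Λ * Z * Q)‖ + ‖(Λ - 1) * (Z * Q)‖ + ‖Z * (Q - 1)‖ := norm_add₃_le
    _ ≤ ‖P - 1‖ * ‖Λ * Z * Q‖ + ‖Λ - 1‖ * ‖Z * Q‖ + ‖Z‖ * ‖Q - 1‖ := by
        gcongr <;> exact norm_mul_le _ _
    _ ≤ ‖P - 1‖ * 1 + ‖Λ - 1‖ * 1 + 1 * ‖Q - 1‖ := by gcongr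
    _ = _ := by ring

variable [NormOneClass 𝔸] in
/-- [folklore] an ordered product of factors of norm `≤ 1` deviates from `1` by at most the sum of the deviations. -/
private theorem norm_pathProd_sub_one_le {g : ℕ → 𝔸ˣ} (hg : ∀ t, ‖((g t : 𝔸ˣ) : 𝔸)‖ ≤ 1) {β : ℝ} :
    ∀ n : ℕ, (∀ t, t < n → ‖((g t : 𝔸ˣ) : 𝔸) - 1‖ ≤ β) → ‖((pathProd g n : 𝔸ˣ) : 𝔸) - 1‖ ≤ n * β
  | 0, _ => by simp [pathProd_zero]
  | n + 1, hβ => by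
    rw [pathProd_succ, Units.val_mul, Nat.cast_succ, add_mul, one_mul]
    have h1 : ‖((pathProd g n : 𝔸ˣ) : 𝔸)‖ ≤ 1 := B12AverageCorridor267.norm_val_pathProd_le_one hg n
    exact (norm_mul_sub_one_le_of_norm_le_one h1).trans
      (add_le_add (norm_pathProd_sub_one_le hg n fun t ht => hβ t (Nat.lt_succ_of_lt ht))
        (hβ n (Nat.lt_succ_self n)))

/-- [folklore] `e^t − 1 ≤ (6/5)·t` for `0 ≤ t ≤ 1/5` (`|e^t − 1 − t| ≤ t²`). -/
private theorem exp_sub_one_le_six_fifths {t : ℝ} (h0 : 0 ≤ t) (h1 : t ≤ 1 / 5) : Real.exp t - 1 ≤ 6 / 5 * t := by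
  have h := Real.abs_exp_sub_one_sub_id_le (x := t) (by rw [abs_of_nonneg h0]; linarith)
  have h' : Real.exp t - 1 - t ≤ t ^ 2 := (le_abs_self _).trans h
  nlinarith

end Elementary

/-! ## § 2  The objects of p. 254–255 on the lineage's geometry -/

section Objects

variable {𝔸 : Type*} [NormedRing 𝔸] [NormedAlgebra ℂ 𝔸] [NormOneClass 𝔸] [CompleteSpace 𝔸] (L : ℕ)

/-- **The average (0.12) built from the averaged contour variables (0.11)** on the corner-cube geometry of the b12
lineage: `Ū(c) = exp[Σ_{x∈B(c₋)} L⁻ᵈ log 𝐔(c₋,x)𝐔([x,x′])𝐔(x′,c₊)𝐔(−c)] 𝐔(c)` = `B12AverageCorridor267.avgM` with the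
transporter family `B12ContourAverage253.Tavg` (Federbush's mean (0.10) of the contour family `𝐆(y,x)`).
[cite: Balaban1987RG1, (0.12) p.254] -/
def avgBar (U : ZdEdge d → 𝔸ˣ) (c : ZdEdge d) : 𝔸ˣ :=
  avgM L (fun U : ZdEdge d → 𝔸ˣ => Tavg L U) U c

/-- **The small field region of p. 255 attached to a coarse configuration `V`** — the three families of restrictions
collected on pp. 254–255: (a) regularity «|U(∂p) − 1| < ε₀, p ∈ T» (p. 254); (b) «The new restrictions on U(y,x)»
of (0.16), `χ({|U(y,x) − 1| < ε₀})` for `y ∈ T⁽¹⁾`, `x ∈ B(y)`, `x ≠ y`, with the averaged contour variables (0.11);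
(c) the connection with `V` introduced by the kernel, «the equalities Ū = V …, or more generally |Ū − V| < ε₀ on bonds
of T⁽¹⁾» (p. 254), with the average (0.12).  Read on `ℤᵈ` with corner cubes `B(y) = L·y + {0,…,L−1}ᵈ` (lineage
DIVERGENCE D-b12g20.1), weak inequalities, configurations with values in the units of a Banach algebra.
[cite: Balaban1987RG1, p.255] -/
def smallFieldRegion (ε₀ : ℝ) (V : ZdEdge d → 𝔸ˣ) : Set (ZdEdge d → 𝔸ˣ) :=
  {U | (∀ (p : Fin d → ℤ) (i j : Fin d), i ≠ j → ‖((plaquetteHolonomyZd U p i j : 𝔸ˣ) : 𝔸) - 1‖ ≤ ε₀) ∧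
       (∀ (y x : Fin d → ℤ), x ∈ blockSites L y → x ≠ blockBase L y → ‖((Tavg L U x : 𝔸ˣ) : 𝔸) - 1‖ ≤ ε₀) ∧
       (∀ c : ZdEdge d, ‖((avgBar L U c : 𝔸ˣ) : 𝔸) - (V c : 𝔸)‖ ≤ ε₀)}

variable {L}

omit [NormOneClass 𝔸] in
/-- [cite: Balaban1987RG1, p.255] unfolding of the membership in the small field region. -/
theorem mem_smallFieldRegion_iff {ε₀ : ℝ} {V : ZdEdge d → 𝔸ˣ} {U : ZdEdge d → 𝔸ˣ} :
    U ∈ smallFieldRegion L ε₀ V ↔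
      (∀ (p : Fin d → ℤ) (i j : Fin d), i ≠ j → ‖((plaquetteHolonomyZd U p i j : 𝔸ˣ) : 𝔸) - 1‖ ≤ ε₀) ∧
      (∀ (y x : Fin d → ℤ), x ∈ blockSites L y → x ≠ blockBase L y → ‖((Tavg L U x : 𝔸ˣ) : 𝔸) - 1‖ ≤ ε₀) ∧
      (∀ c : ZdEdge d, ‖((avgBar L U c : 𝔸ˣ) : 𝔸) - (V c : 𝔸)‖ ≤ ε₀) :=
  Iff.rfl

end Objects

/-! ## § 3  Inside a block: the tree transporters and the bond variables are `O(1)ε₀`-close to `1` -/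

section InBlock

variable {𝔸 : Type*} [NormedRing 𝔸] [NormedAlgebra ℂ 𝔸] [NormOneClass 𝔸] [CompleteSpace 𝔸] {L : ℕ}

omit [NormedAlgebra ℂ 𝔸] [NormOneClass 𝔸] [CompleteSpace 𝔸] in
/-- [folklore] the tree transporter to the base point is trivial: `U(Γ_{q,q}) = 1`. -/
private theorem gammaT_blockBase (hL : 0 < L) (U : ZdEdge d → 𝔸ˣ) (y : Fin d → ℤ) :
    gammaT L U (blockBase L y) = 1 := by
  haveI : NeZero L := ⟨hL.ne'⟩
  rw [gammaT_eq_hol_treeWord hL, Literature.MathematicalPhysics.QuantumLattice.blockMap_blockBase, sub_self,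
    treeWord_zero, hol_nil]

/-- **The restriction (0.16) controls the tree contours**: for `x ∈ B(y)`, `‖U(Γ_{q,x}) − 1‖ ≤ (4(dL)² + 1)·ε₀`
when `‖𝐔(q,x) − 1‖ ≤ ε₀` (for `x ≠ q`), the plaquettes are `ε₀`-regular and `(dL)²ε₀ ≤ 1/100` — from
`‖𝐔(q,x)U(Γ_{q,x})⁻¹ − 1‖ ≤ 4(dL)²ε₀` (`B12ContourAverage253.norm_Tavg_mul_gammaT_inv_sub_one_le`).
[cite: Balaban1987RG1, (0.16) p.255] -/
theorem norm_gammaT_sub_one_le (hL : 0 < L) (U : ZdEdge d → 𝔸ˣ) (hU : ∀ b, U b ∈ U1 𝔸) {ε₀ : ℝ}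
    (hε₀ : 0 ≤ ε₀) (hsm : ((d : ℝ) * L) ^ 2 * ε₀ ≤ 1 / 100)
    (h44 : ∀ (p : Fin d → ℤ) (i j : Fin d), i ≠ j → ‖((plaquetteHolonomyZd U p i j : 𝔸ˣ) : 𝔸) - 1‖ ≤ ε₀)
    {y x : Fin d → ℤ} (hx : x ∈ blockSites L y)
    (hgf : x ≠ blockBase L y → ‖((Tavg L U x : 𝔸ˣ) : 𝔸) - 1‖ ≤ ε₀) :
    ‖((gammaT L U x : 𝔸ˣ) : 𝔸) - 1‖ ≤ (4 * ((d : ℝ) * L) ^ 2 + 1) * ε₀ := by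
  by_cases hxq : x = blockBase L y
  · rw [hxq, gammaT_blockBase hL, Units.val_one, sub_self, norm_zero]; positivity
  have hG : ‖((gammaT L U x : 𝔸ˣ) : 𝔸)‖ ≤ 1 := by
    rw [gammaT_eq_hol_treeWord hL]
    exact (mem_U1.mp (hol_mem (fun z κ => hU (z, κ)) _ _)).1
  have hrel := norm_Tavg_mul_gammaT_inv_sub_one_le hL U (fun b => (mem_U1.mp (hU b)).1)
    (fun b => (mem_U1.mp (hU b)).2) hε₀ hsm hx (fun p i j hij _ _ => h44 p i j hij)
  rw [Units.val_mul] at hrel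
  calc ‖((gammaT L U x : 𝔸ˣ) : 𝔸) - 1‖
      ≤ ‖((Tavg L U x : 𝔸ˣ) : 𝔸) - 1‖ + ‖((Tavg L U x : 𝔸ˣ) : 𝔸) * (((gammaT L U x)⁻¹ : 𝔸ˣ) : 𝔸) - 1‖ :=
        norm_sub_one_le_of_rel hG _
    _ ≤ ε₀ + 4 * (((d : ℝ) * L) ^ 2 * ε₀) := add_le_add (hgf hxq) hrel
    _ = (4 * ((d : ℝ) * L) ^ 2 + 1) * ε₀ := by ring

omit [NormedAlgebra ℂ 𝔸] [NormOneClass 𝔸] [CompleteSpace 𝔸] in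
/-- [folklore] the hypothesis (44) of [B7] in the word calculus, from print's plaquette regularity on `ℤᵈ`. -/
private theorem h44_curry {U : ZdEdge d → 𝔸ˣ} {ε₀ : ℝ}
    (h44 : ∀ (p : Fin d → ℤ) (i j : Fin d), i ≠ j → ‖((plaquetteHolonomyZd U p i j : 𝔸ˣ) : 𝔸) - 1‖ ≤ ε₀)
    (x : Fin d → ℤ) (κ μ : Fin d) (hκμ : κ ≠ μ) :
    ‖((hol (Function.curry U) x (plaqWord κ μ) : 𝔸ˣ) : 𝔸) - 1‖ ≤ ε₀ := by
  rw [hol_curry_plaqWord]; exact h44 x κ μ hκμ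

/-- [folklore] `|x − L y|₁ ≤ d·L` for `x ∈ B(y)`. -/
private theorem l1_sub_blockBase_le {y x : Fin d → ℤ} (hx : x ∈ blockSites L y) :
    (l1 (x - blockBase L y) : ℝ) ≤ (d : ℝ) * L := by
  obtain ⟨r, hr⟩ := exists_boxVec hx
  rw [hr]; exact_mod_cast l1_boxVec_le L r

/-- [cite: Balaban1985Averaging, p.24] the axial gauge identity of [B7] p. 24 («we make a gauge transformation v₀
such that the gauge transformed configuration V₀ = V^{v₀} satisfies the conditions V₀(Γ_{y,x}) = 1») read backwards:
`U(x, x+e_μ) = U(Γ_{q,x})⁻¹ · U₀(x, x+e_μ) · U(Γ_{q,x+e_μ})` (`B7Prop1Explicit.axialFn`/`gaugeAct`). -/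
theorem bond_eq_axial_conj {G : Type*} [Group G] (W : (Fin d → ℤ) → Fin d → G) (q x : Fin d → ℤ) (μ : Fin d) :
    W x μ = (axialFn W q x)⁻¹ * gaugeAct (axialFn W q) W x μ * axialFn W q (x + e μ) := by
  unfold gaugeAct; group

/-- **IN-BLOCK BONDS ARE `O(1)ε₀`-CLOSE TO `1` IN THE REGION**: for a bond `b = ⟨x, x + e_μ⟩` with both endpoints in
`B(y)`, `‖U(b) − 1‖ ≤ (dL + 2(4(dL)² + 1))·ε₀`, from the axial-gauge bond bound of [B7] pp. 24–25
(`B7Prop1Explicit.axial_bond_bound`, the non-abelian Stokes ladder: `‖U₀(b) − 1‖ ≤ |x − q|₁ε₀`) and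
`norm_gammaT_sub_one_le` at both endpoints. [cite: Balaban1987RG1, p.255] -/
theorem norm_inBlock_sub_one_le (hL : 0 < L) (U : ZdEdge d → 𝔸ˣ) (hU : ∀ b, U b ∈ U1 𝔸) {ε₀ : ℝ}
    (hε₀ : 0 ≤ ε₀) (hsm : ((d : ℝ) * L) ^ 2 * ε₀ ≤ 1 / 100)
    (h44 : ∀ (p : Fin d → ℤ) (i j : Fin d), i ≠ j → ‖((plaquetteHolonomyZd U p i j : 𝔸ˣ) : 𝔸) - 1‖ ≤ ε₀)
    (hgf : ∀ (y x : Fin d → ℤ), x ∈ blockSites L y → x ≠ blockBase L y → ‖((Tavg L U x : 𝔸ˣ) : 𝔸) - 1‖ ≤ ε₀)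
    {y : Fin d → ℤ} {b : ZdEdge d} (hb : b.1 ∈ blockSites L y) (hb' : b.1 + Pi.single b.2 1 ∈ blockSites L y) :
    ‖((U b : 𝔸ˣ) : 𝔸) - 1‖ ≤ ((d : ℝ) * L + 2 * (4 * ((d : ℝ) * L) ^ 2 + 1)) * ε₀ := by
  haveI : NeZero L := ⟨hL.ne'⟩
  set W : (Fin d → ℤ) → Fin d → 𝔸ˣ := Function.curry U with hWdef
  set q := blockBase L y with hq
  have hW : ∀ x κ, W x κ ∈ U1 𝔸 := fun x κ => hU (x, κ)
  have hy : blockMap L b.1 = y := (mem_blockSites_iff L y _).1 hb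
  have hy' : blockMap L (b.1 + Pi.single b.2 1) = y := (mem_blockSites_iff L y _).1 hb'
  -- the two tree transporters are the axial gauge function at the endpoints
  have hT1 : axialFn W q b.1 = gammaT L U b.1 := by
    rw [gammaT_eq_hol_treeWord hL U b.1, hy]; rfl
  have hT2 : axialFn W q (b.1 + e b.2) = gammaT L U (b.1 + Pi.single b.2 1) := by
    rw [gammaT_eq_hol_treeWord hL U _, hy']; rfl
  have hτ1 := norm_gammaT_sub_one_le hL U hU hε₀ hsm h44 hb (hgf y b.1 hb)
  have hτ2 := norm_gammaT_sub_one_le hL U hU hε₀ hsm h44 hb' (hgf y _ hb')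
  -- the axial-gauge bond variable
  have hA := axial_bond_bound W hW q (h44_curry h44) hε₀ b.1 b.2
  have hl1 : (l1 (b.1 - q) : ℝ) * ε₀ ≤ (d : ℝ) * L * ε₀ :=
    mul_le_mul_of_nonneg_right (l1_sub_blockBase_le hb) hε₀
  have hid : ((U b : 𝔸ˣ) : 𝔸) = (((axialFn W q b.1)⁻¹ : 𝔸ˣ) : 𝔸) *
      ((gaugeAct (axialFn W q) W b.1 b.2 : 𝔸ˣ) : 𝔸) * ((axialFn W q (b.1 + e b.2) : 𝔸ˣ) : 𝔸) := by
    rw [← Units.val_mul, ← Units.val_mul, ← bond_eq_axial_conj]; rfl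
  have hPm : axialFn W q b.1 ∈ U1 𝔸 := axialFn_mem hW q _
  have hQm : axialFn W q (b.1 + e b.2) ∈ U1 𝔸 := axialFn_mem hW q _
  have hP1 : ‖(((axialFn W q b.1)⁻¹ : 𝔸ˣ) : 𝔸)‖ ≤ 1 := (mem_U1.mp hPm).2
  have hQ1 : ‖((axialFn W q (b.1 + e b.2) : 𝔸ˣ) : 𝔸)‖ ≤ 1 := (mem_U1.mp hQm).1
  have hPsub : ‖(((axialFn W q b.1)⁻¹ : 𝔸ˣ) : 𝔸) - 1‖ ≤ (4 * ((d : ℝ) * L) ^ 2 + 1) * ε₀ := by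
    refine (norm_inv_sub_one_le hPm).trans ?_
    rw [hT1]; exact hτ1
  have hQsub : ‖((axialFn W q (b.1 + e b.2) : 𝔸ˣ) : 𝔸) - 1‖ ≤ (4 * ((d : ℝ) * L) ^ 2 + 1) * ε₀ := by
    rw [hT2]; exact hτ2
  rw [hid]
  refine (norm_triple_sub_one_le _ _ _).trans ?_
  have hτ0 : 0 ≤ (4 * ((d : ℝ) * L) ^ 2 + 1) * ε₀ := by positivity
  calc ‖(((axialFn W q b.1)⁻¹ : 𝔸ˣ) : 𝔸)‖ * ‖((gaugeAct (axialFn W q) W b.1 b.2 : 𝔸ˣ) : 𝔸) - 1‖ *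
          ‖((axialFn W q (b.1 + e b.2) : 𝔸ˣ) : 𝔸)‖ +
        ‖(((axialFn W q b.1)⁻¹ : 𝔸ˣ) : 𝔸) - 1‖ * ‖((axialFn W q (b.1 + e b.2) : 𝔸ˣ) : 𝔸)‖ +
        ‖((axialFn W q (b.1 + e b.2) : 𝔸ˣ) : 𝔸) - 1‖
      ≤ 1 * ((d : ℝ) * L * ε₀) * 1 + (4 * ((d : ℝ) * L) ^ 2 + 1) * ε₀ * 1 + (4 * ((d : ℝ) * L) ^ 2 + 1) * ε₀ := by
        gcongr
        · exact hA.trans hl1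
    _ = ((d : ℝ) * L + 2 * (4 * ((d : ℝ) * L) ^ 2 + 1)) * ε₀ := by ring

end InBlock

/-! ## § 4  Across two blocks: the bond on the axis of `c` is `O(1)ε₀`-close to `V(c)` -/

section Axis

variable {𝔸 : Type*} [NormedRing 𝔸] [NormedAlgebra ℂ 𝔸] [NormOneClass 𝔸] [CompleteSpace 𝔸] {L : ℕ}

omit [NormOneClass 𝔸] in
/-- [cite: Balaban1987RG1, (0.12) p.254] the average (0.12) with the averaged contour variables factorises as
`Ū(c) = exp[Y(c)] · U([L c₋, L c₋ + (L−1)e_μ]) · U(b₀(c))`, `Y(c)` the sum of the `Lᵈ − L` off-axis logarithms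
(the axis loops are `1`: `B12AverageCorridor267.loopW_axisSite` for the axis-straight family `𝐔`). -/
theorem avgBar_eq (hL : 0 < L) (U : ZdEdge d → 𝔸ˣ) (c : ZdEdge d) :
    avgBar L U c = expU (Yexp L (fun U : ZdEdge d → 𝔸ˣ => Tavg L U) U c) * (gcorner L U c * U (b0Z L c)) := by
  unfold avgBar avgM
  rw [Ustr_eq_gcorner_mul hL, sum_blockSites_eq hL c, sum_eq_zero fun l hl => ?_, zero_add]
  · rfl
  · rw [loopW_axisSite (isAxisStraightFamily_Tavg hL) U c (mem_range.1 hl), Units.val_one, mlog_one, smul_zero]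

omit [NormedAlgebra ℂ 𝔸] [CompleteSpace 𝔸] in
/-- [cite: Balaban1987RG1, (0.12) p.254] the straight piece `U([L c₋, L c₋ + (L−1)e_μ])` of the factor `U(c)` of
(0.12) is a product of `L − 1` in-block bonds of `B(c₋)`, hence `‖· − 1‖ ≤ (L−1)·β` when every in-block bond of
`B(c₋)` is within `β` of `1`. -/
theorem norm_gcorner_sub_one_le (hL : 0 < L) (U : ZdEdge d → 𝔸ˣ) (hU : ∀ b, U b ∈ U1 𝔸) (c : ZdEdge d) {β : ℝ}
    (hβ : ∀ b : ZdEdge d, b.1 ∈ blockSites L c.1 → b.1 + Pi.single b.2 1 ∈ blockSites L c.1 →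
      ‖((U b : 𝔸ˣ) : 𝔸) - 1‖ ≤ β) :
    ‖((gcorner L U c : 𝔸ˣ) : 𝔸) - 1‖ ≤ ((L : ℝ) - 1) * β := by
  have hcast : ((L - 1 : ℕ) : ℝ) = (L : ℝ) - 1 := by
    rw [Nat.cast_sub (Nat.one_le_of_lt hL), Nat.cast_one]
  rw [← hcast]
  unfold gcorner lineR
  refine norm_pathProd_sub_one_le (fun t => (mem_U1.mp (hU _)).1) (L - 1) fun t ht => hβ _ ?_ ?_
  · exact B12ContourAverage253.single_natCast_mem_blockSites hL c.1 c.2 (by omega)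
  · have : blockBase L c.1 + Pi.single c.2 (t : ℤ) + Pi.single c.2 (1 : ℤ)
        = blockBase L c.1 + Pi.single c.2 ((t + 1 : ℕ) : ℤ) := by
      rw [add_assoc, ← Pi.single_add, Nat.cast_succ]
    rw [this]
    exact B12ContourAverage253.single_natCast_mem_blockSites hL c.1 c.2 (by omega)

/-- **THE AXIS BOND OF A COARSE BOND IS `O(1)ε₀`-CLOSE TO `V(c)`**: if the off-axis (0.12) loops satisfy
`‖W_x − 1‖ ≤ ω ≤ 1/10`, every in-block bond of `B(c₋)` is within `β` of `1`, and `‖Ū(c) − V(c)‖ ≤ ε₀`, then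
`‖U(b₀(c)) − V(c)‖ ≤ ε₀ + (12/5)ω + (5/4)(L−1)β` (`‖Y(c)‖ ≤ 2ω` by `B12AverageCorridor267.norm_Yexp_le`,
`‖e^Y − 1‖ ≤ e^{2ω} − 1 ≤ (12/5)ω`). [cite: Balaban1987RG1, p.255] -/
theorem norm_axisBond_sub_le (hL : 0 < L) (U : ZdEdge d → 𝔸ˣ) (hU : ∀ b, U b ∈ U1 𝔸) (V : ZdEdge d → 𝔸ˣ)
    (c : ZdEdge d) {ε₀ ω β : ℝ} (hω0 : 0 ≤ ω) (hω : ω ≤ 1 / 10) (hβ0 : 0 ≤ β)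
    (hW : ∀ x ∈ offAxis L c, ‖((loopW L (fun U : ZdEdge d → 𝔸ˣ => Tavg L U) U c x : 𝔸ˣ) : 𝔸) - 1‖ ≤ ω)
    (hβ : ∀ b : ZdEdge d, b.1 ∈ blockSites L c.1 → b.1 + Pi.single b.2 1 ∈ blockSites L c.1 →
      ‖((U b : 𝔸ˣ) : 𝔸) - 1‖ ≤ β)
    (hV : ‖((avgBar L U c : 𝔸ˣ) : 𝔸) - (V c : 𝔸)‖ ≤ ε₀) :
    ‖((U (b0Z L c) : 𝔸ˣ) : 𝔸) - (V c : 𝔸)‖ ≤ ε₀ + 12 / 5 * ω + 5 / 4 * (((L : ℝ) - 1) * β) := by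
  set Y := Yexp L (fun U : ZdEdge d → 𝔸ˣ => Tavg L U) U c with hYdef
  have hY : ‖Y‖ ≤ 2 * ω := norm_Yexp_le hL U c hω0 (by linarith) hW
  have hexp : ‖exp Y - 1‖ ≤ 12 / 5 * ω := by
    refine (B7Prop1Explicit.norm_exp_sub_one_le_of_norm_le hY).1.trans ?_
    have := exp_sub_one_le_six_fifths (t := 2 * ω) (by linarith) (by linarith)
    linarith
  have hexp1 : ‖exp Y‖ ≤ 5 / 4 :=
    (B12ContourAverage253.norm_le_one_add hexp).trans (by linarith)
  have hg := norm_gcorner_sub_one_le hL U hU c hβ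
  have hgβ0 : 0 ≤ ((L : ℝ) - 1) * β := by
    have : (1 : ℝ) ≤ L := by exact_mod_cast hL
    exact mul_nonneg (by linarith) hβ0
  -- `Ū(c) = e^Y g U(b₀)`, so `U(b₀) − Ū(c) = (1 − e^Y g) U(b₀)`
  have hid : ((U (b0Z L c) : 𝔸ˣ) : 𝔸) - ((avgBar L U c : 𝔸ˣ) : 𝔸)
      = (1 - exp Y * ((gcorner L U c : 𝔸ˣ) : 𝔸)) * ((U (b0Z L c) : 𝔸ˣ) : 𝔸) := by
    rw [avgBar_eq hL U c, Units.val_mul, Units.val_mul, val_expU, sub_mul, one_mul, mul_assoc]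
  have hkey : ‖exp Y * ((gcorner L U c : 𝔸ˣ) : 𝔸) - 1‖ ≤ 5 / 4 * (((L : ℝ) - 1) * β) + 12 / 5 * ω := by
    have h' : exp Y * ((gcorner L U c : 𝔸ˣ) : 𝔸) - 1
        = exp Y * (((gcorner L U c : 𝔸ˣ) : 𝔸) - 1) + (exp Y - 1) := by noncomm_ring
    rw [h']
    calc ‖exp Y * (((gcorner L U c : 𝔸ˣ) : 𝔸) - 1) + (exp Y - 1)‖
        ≤ ‖exp Y‖ * ‖((gcorner L U c : 𝔸ˣ) : 𝔸) - 1‖ + ‖exp Y - 1‖ :=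
          (norm_add_le _ _).trans (add_le_add (norm_mul_le _ _) le_rfl)
      _ ≤ 5 / 4 * (((L : ℝ) - 1) * β) + 12 / 5 * ω := by gcongr
  calc ‖((U (b0Z L c) : 𝔸ˣ) : 𝔸) - (V c : 𝔸)‖
      = ‖(((U (b0Z L c) : 𝔸ˣ) : 𝔸) - ((avgBar L U c : 𝔸ˣ) : 𝔸)) + (((avgBar L U c : 𝔸ˣ) : 𝔸) - (V c : 𝔸))‖ := by
        rw [sub_add_sub_cancel]
    _ ≤ ‖((U (b0Z L c) : 𝔸ˣ) : 𝔸) - ((avgBar L U c : 𝔸ˣ) : 𝔸)‖ + ‖((avgBar L U c : 𝔸ˣ) : 𝔸) - (V c : 𝔸)‖ :=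
        norm_add_le _ _
    _ ≤ ‖1 - exp Y * ((gcorner L U c : 𝔸ˣ) : 𝔸)‖ * ‖((U (b0Z L c) : 𝔸ˣ) : 𝔸)‖ + ε₀ := by
        rw [hid]; exact add_le_add (norm_mul_le _ _) hV
    _ ≤ (5 / 4 * (((L : ℝ) - 1) * β) + 12 / 5 * ω) * 1 + ε₀ := by
        gcongr
        · rw [norm_sub_rev]; exact hkey
        · exact (mem_U1.mp (hU _)).1
    _ = ε₀ + 12 / 5 * ω + 5 / 4 * (((L : ℝ) - 1) * β) := by ring

end Axis

/-! ## § 5  Across two blocks: every crossing bond is `O(1)ε₀`-close to the axis bond (non-abelian Stokes ladder) -/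

section CrossingGeometry

variable {L : ℕ}

/-- [folklore] a bond `⟨x, x + e_μ⟩` of `B(y)` leaving the block sits on the face `x_μ = L y_μ + L − 1`. -/
private theorem crossing_coord (hL : 0 < L) {y x : Fin d → ℤ} (hx : x ∈ blockSites L y) {μ : Fin d}
    (hx' : x + Pi.single μ 1 ∉ blockSites L y) : x μ = blockBase L y μ + L - 1 := by
  have hb := bounds_of_mem_blockSites hx
  by_contra h
  apply hx'
  refine mem_blockSites_of_bounds hL fun i => ?_
  by_cases hi : i = μ
  · subst hi; simp only [Pi.add_apply, Pi.single_eq_same]; have := hb i; omega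
  · simp only [Pi.add_apply, Pi.single_eq_of_ne hi, add_zero]; exact hb i

/-- [folklore] the letters of a tree word `Γ_{a, a+v}` with `v_μ = 0` are not `±e_μ`. -/
private theorem fst_ne_of_mem_treeWord {v : Fin d → ℤ} {μ : Fin d} (hv : v μ = 0) {l : Letter d}
    (hl : l ∈ treeWord v) : l.1 ≠ μ := by
  rw [treeWord_eq_tw, tw, List.mem_flatMap] at hl
  obtain ⟨κ, -, hκ⟩ := hl
  have h1 := mem_seg hκ
  intro h
  rw [h] at h1
  subst h1
  rw [hv, seg_zero] at hκ
  simp at hκ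

/-- [folklore] `|v|₁ ≤ d·L` for `0 ≤ v ≤ L − 1` coordinatewise. -/
private theorem l1_le_of_bounds {v : Fin d → ℤ} (hv : ∀ i, 0 ≤ v i ∧ v i ≤ (L : ℤ) - 1) : (l1 v : ℝ) ≤ (d : ℝ) * L := by
  have h : l1 v ≤ d * L := by
    unfold l1
    calc ∑ κ, (v κ).natAbs ≤ ∑ _κ : Fin d, L := Finset.sum_le_sum fun κ _ => by have := hv κ; omega
      _ = d * L := by simp
  exact_mod_cast h

end CrossingGeometry

section Crossing

variable {𝔸 : Type*} [NormedRing 𝔸] [NormOneClass 𝔸] {L : ℕ}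

/-- [folklore] a bond `⟨p, p + e_κ⟩` squeezed between two sites of the block `B(y)` lies in `B(y)`. -/
private theorem bond_mem_of_between (hL : 0 < L) {y lo hi p : Fin d → ℤ} {κ : Fin d}
    (hlo : ∀ i, blockBase L y i ≤ lo i) (hhi : ∀ i, hi i < blockBase L y i + L) (h1 : lo ≤ p) (h2 : p + e κ ≤ hi) :
    p ∈ blockSites L y ∧ p + Pi.single κ 1 ∈ blockSites L y := by
  have he := e_nonneg κ
  have key : ∀ i, blockBase L y i ≤ p i ∧ p i + e κ i < blockBase L y i + L ∧ 0 ≤ e κ i := fun i => by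
    have a1 := hlo i
    have a2 : lo i ≤ p i := h1 i
    have a3 : p i + e κ i ≤ hi i := h2 i
    have a4 : 0 ≤ e κ i := he i
    have a5 := hhi i
    exact ⟨a1.trans a2, by omega, a4⟩
  constructor
  · refine mem_blockSites_of_bounds hL fun i => ?_
    obtain ⟨b1, b2, b3⟩ := key i
    exact ⟨b1, by omega⟩
  · refine mem_blockSites_of_bounds hL fun i => ?_
    obtain ⟨b1, b2, b3⟩ := key i
    change blockBase L y i ≤ (p + e κ) i ∧ (p + e κ) i < blockBase L y i + L
    rw [Pi.add_apply]
    exact ⟨by omega, b2⟩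

/-- **EVERY CROSSING BOND IS `O(1)ε₀`-CLOSE TO THE AXIS BOND OF ITS COARSE BOND** (the lattice non-abelian Stokes
estimate in ladder form, `B7Prop1Explicit.ladder_bound`): for `x ∈ B(y)` with `x + e_μ ∉ B(y)` and
`a = L y + (L−1)e_μ = b₀(c)₋`, `c = ⟨y, y + e_μ⟩`, the ladder `Γ_{a,x} ∪ [x, x+e_μ] ∪ (−Γ_{a,x} − e_μ) ∪ [a+e_μ, a]` has
holonomy within `|x − a|₁ε₀` of `1` and its two long sides are products of in-block bonds of `B(y)`, `B(y + e_μ)`, so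
`‖U(x, x+e_μ) − U(b₀(c))‖ ≤ dL·(ε₀ + 2β)` when every in-block bond is within `β` of `1`.
[cite: Balaban1987RG1, p.255] -/
theorem norm_crossing_sub_axisBond_le (hL : 0 < L) (U : ZdEdge d → 𝔸ˣ) (hU : ∀ b, U b ∈ U1 𝔸) {ε₀ β : ℝ}
    (hε₀ : 0 ≤ ε₀) (hβ0 : 0 ≤ β)
    (h44 : ∀ (p : Fin d → ℤ) (i j : Fin d), i ≠ j → ‖((plaquetteHolonomyZd U p i j : 𝔸ˣ) : 𝔸) - 1‖ ≤ ε₀)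
    (hβ : ∀ (y : Fin d → ℤ) (b : ZdEdge d), b.1 ∈ blockSites L y → b.1 + Pi.single b.2 1 ∈ blockSites L y →
      ‖((U b : 𝔸ˣ) : 𝔸) - 1‖ ≤ β)
    {y x : Fin d → ℤ} {μ : Fin d} (hx : x ∈ blockSites L y) (hx' : x + Pi.single μ 1 ∉ blockSites L y) :
    ‖((U (x, μ) : 𝔸ˣ) : 𝔸) - ((U (b0Z L (y, μ)) : 𝔸ˣ) : 𝔸)‖ ≤ (d : ℝ) * L * (ε₀ + 2 * β) := by
  set W : (Fin d → ℤ) → Fin d → 𝔸ˣ := Function.curry U with hWdef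
  have hW : ∀ x κ, W x κ ∈ U1 𝔸 := fun x κ => hU (x, κ)
  set a : Fin d → ℤ := blockBase L y + Pi.single μ ((L : ℤ) - 1) with ha
  have hb0 : b0Z L (y, μ) = (a, μ) := rfl
  have hxb := bounds_of_mem_blockSites hx
  have hxμ : x μ = blockBase L y μ + L - 1 := crossing_coord hL hx hx'
  have haμ : a μ = blockBase L y μ + (L - 1) := by simp [ha]
  have hai : ∀ i, i ≠ μ → a i = blockBase L y i := fun i hi => by simp [ha, Pi.single_eq_of_ne hi]
  have h1L : (1 : ℤ) ≤ L := by exact_mod_cast hL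
  have ha_ge : ∀ i, blockBase L y i ≤ a i := fun i => by
    by_cases hi : i = μ
    · rw [hi, haμ]; omega
    · rw [hai i hi]
  have hxa : ∀ i, x i < a i + L := fun i => by
    by_cases hi : i = μ
    · rw [hi, haμ]; omega
    · rw [hai i hi]; exact (hxb i).2
  set v : Fin d → ℤ := x - a with hvdef
  have hav : a + v = x := by rw [hvdef]; abel
  have hvi : ∀ i, v i = x i - a i := fun i => rfl
  have hvb : ∀ i, 0 ≤ v i ∧ v i ≤ (L : ℤ) - 1 := fun i => by
    rw [hvi]
    by_cases hi : i = μ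
    · rw [hi, haμ]; omega
    · rw [hai i hi]; have := hxb i; omega
  have hv0 : (0 : Fin d → ℤ) ≤ v := fun i => (hvb i).1
  have hvμ : v μ = 0 := by rw [hvi, haμ]; omega
  set P := treeWord v with hPdef
  have hPfw : ∀ l ∈ P, l = (l.1, true) := fun l hl => forward_of_mem_tw hv0 (by rwa [hPdef, treeWord_eq_tw] at hl)
  have hPμ : ∀ l ∈ P, l.1 ≠ μ := fun l hl => fst_ne_of_mem_treeWord hvμ hl
  have hPlen : (P.length : ℝ) ≤ (d : ℝ) * L := by
    rw [hPdef, length_treeWord]; exact l1_le_of_bounds hvb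
  have hdisp : disp P = v := by rw [hPdef, disp_treeWord]
  -- the ladder identity and its bound
  have hlad := hol_ladder W a P μ
  rw [hdisp, hav] at hlad
  have hΛ : ‖((hol W a (ladder P μ) : 𝔸ˣ) : 𝔸) - 1‖ ≤ P.length * ε₀ :=
    ladder_bound W hW μ (fun z l hl => norm_hol_lplaqWord_sub_one_le W hW (h44_curry h44) z l μ hl) P a hPμ
  have hid : W x μ = (hol W a P)⁻¹ * hol W a (ladder P μ) * W a μ * hol W (a + e μ) P := by
    rw [hlad]; group
  -- the two long sides are products of in-block bonds of `B(y)` and `B(y + e_μ)`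
  have hside1 : ‖((hol W a P : 𝔸ˣ) : 𝔸) - 1‖ ≤ P.length * β := by
    refine forward_walk W hW P a hPfw fun p κ hap hpx => ?_
    rw [hdisp, hav] at hpx
    obtain ⟨m1, m2⟩ := bond_mem_of_between hL ha_ge (fun i => (hxb i).2) hap hpx
    exact hβ y (p, κ) m1 m2
  have ha' : a + e μ = blockBase L (y + Pi.single μ 1) := by
    rw [B12AverageCorridor267.blockBase_add_single, ha, add_assoc]
    congr 1
    show (Pi.single μ ((L : ℤ) - 1) + Pi.single μ (1 : ℤ) : Fin d → ℤ) = Pi.single μ (L : ℤ)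
    rw [← Pi.single_add, sub_add_cancel]
  have hside2 : ‖((hol W (a + e μ) P : 𝔸ˣ) : 𝔸) - 1‖ ≤ P.length * β := by
    refine forward_walk W hW P (a + e μ) hPfw fun p κ hap hpx => ?_
    rw [hdisp, show a + e μ + v = x + e μ by rw [← hav]; abel] at hpx
    obtain ⟨m1, m2⟩ := bond_mem_of_between hL (y := y + Pi.single μ 1) (fun i => by rw [← ha'])
      (fun i => by
        rw [← ha', Pi.add_apply, Pi.add_apply]
        have := hxa i
        omega) hap hpx
    exact hβ (y + Pi.single μ 1) (p, κ) m1 m2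
  -- assemble
  have hU1 : ((U (x, μ) : 𝔸ˣ) : 𝔸) = (((hol W a P)⁻¹ : 𝔸ˣ) : 𝔸) * ((hol W a (ladder P μ) : 𝔸ˣ) : 𝔸) *
      ((W a μ : 𝔸ˣ) : 𝔸) * ((hol W (a + e μ) P : 𝔸ˣ) : 𝔸) := by
    rw [← Units.val_mul, ← Units.val_mul, ← Units.val_mul, ← hid]; rfl
  have hZ : ((U (b0Z L (y, μ)) : 𝔸ˣ) : 𝔸) = ((W a μ : 𝔸ˣ) : 𝔸) := by rw [hb0]; rfl
  rw [hU1, hZ]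
  have hm1 : hol W a (ladder P μ) * W a μ * hol W (a + e μ) P ∈ U1 𝔸 :=
    (U1 𝔸).mul_mem ((U1 𝔸).mul_mem (hol_mem hW _ _) (hW _ _)) (hol_mem hW _ _)
  have hm2 : W a μ * hol W (a + e μ) P ∈ U1 𝔸 := (U1 𝔸).mul_mem (hW _ _) (hol_mem hW _ _)
  have hn1 := (mem_U1.mp hm1).1
  have hn2 := (mem_U1.mp hm2).1
  rw [Units.val_mul, Units.val_mul] at hn1
  rw [Units.val_mul] at hn2
  refine (norm_four_sub_mid_le hn1 hn2 (mem_U1.mp (hW _ _)).1).trans ?_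
  have hinv : ‖(((hol W a P)⁻¹ : 𝔸ˣ) : 𝔸) - 1‖ ≤ P.length * β :=
    (norm_inv_sub_one_le (hol_mem hW _ _)).trans hside1
  calc ‖(((hol W a P)⁻¹ : 𝔸ˣ) : 𝔸) - 1‖ + ‖((hol W a (ladder P μ) : 𝔸ˣ) : 𝔸) - 1‖ +
        ‖((hol W (a + e μ) P : 𝔸ˣ) : 𝔸) - 1‖
      ≤ P.length * β + P.length * ε₀ + P.length * β := add_le_add (add_le_add hinv hΛ) hside2
    _ = P.length * (ε₀ + 2 * β) := by ring
    _ ≤ (d : ℝ) * L * (ε₀ + 2 * β) := mul_le_mul_of_nonneg_right hPlen (by positivity)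

end Crossing

/-! ## § 6  The printed sentence: the small field region has diameter `O(1)ε₀`, bond by bond -/

section Main

variable {𝔸 : Type*} [NormedRing 𝔸] [NormedAlgebra ℂ 𝔸] [NormOneClass 𝔸] [CompleteSpace 𝔸] {L : ℕ}

omit [NormedRing 𝔸] [NormedAlgebra ℂ 𝔸] [NormOneClass 𝔸] [CompleteSpace 𝔸] in
/-- [folklore] numeric bookkeeping: `N = dL ≥ 1`. -/
private theorem one_le_dL (hL : 0 < L) (hd : 1 ≤ d) : (1 : ℝ) ≤ (d : ℝ) * L := by
  have h1 : (1 : ℝ) ≤ d := by exact_mod_cast hd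
  have h2 : (1 : ℝ) ≤ L := by exact_mod_cast hL
  nlinarith

/-- **IN THE SMALL FIELD REGION EVERY IN-BLOCK BOND IS WITHIN `11(dL)²ε₀` OF `1`** (`U1`-valued configurations,
`(dL)²ε₀ ≤ 1/100`, `d ≥ 1`). [cite: Balaban1987RG1, p.255] -/
theorem norm_sub_one_le_of_mem_inBlock (hL : 0 < L) (hd : 1 ≤ d) {ε₀ : ℝ} (hε₀ : 0 ≤ ε₀)
    (hsm : ((d : ℝ) * L) ^ 2 * ε₀ ≤ 1 / 100) {V U : ZdEdge d → 𝔸ˣ} (hU : ∀ b, U b ∈ U1 𝔸)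
    (hmem : U ∈ smallFieldRegion L ε₀ V) {y : Fin d → ℤ} {b : ZdEdge d} (hb : b.1 ∈ blockSites L y)
    (hb' : b.1 + Pi.single b.2 1 ∈ blockSites L y) :
    ‖((U b : 𝔸ˣ) : 𝔸) - 1‖ ≤ 11 * ((d : ℝ) * L) ^ 2 * ε₀ := by
  obtain ⟨h44, hgf, -⟩ := hmem
  refine (norm_inBlock_sub_one_le hL U hU hε₀ hsm h44 hgf hb hb').trans ?_
  have hN := one_le_dL hL hd
  set N := (d : ℝ) * L
  have : 0 ≤ (3 * N + 2) * (N - 1) * ε₀ := mul_nonneg (mul_nonneg (by linarith) (by linarith)) hε₀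
  nlinarith

/-- **IN THE SMALL FIELD REGION EVERY BOND CROSSING FROM `B(y)` TO `B(y + e_μ)` IS WITHIN `62(dL)³ε₀` OF THE COARSE
VARIABLE `V(⟨y, y + e_μ⟩)`**. [cite: Balaban1987RG1, p.255] -/
theorem norm_sub_coarse_le_of_mem_crossing (hL : 0 < L) (hd : 1 ≤ d) {ε₀ : ℝ} (hε₀ : 0 ≤ ε₀)
    (hsm : ((d : ℝ) * L) ^ 2 * ε₀ ≤ 1 / 100) {V U : ZdEdge d → 𝔸ˣ} (hU : ∀ b, U b ∈ U1 𝔸)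
    (hmem : U ∈ smallFieldRegion L ε₀ V) {y x : Fin d → ℤ} {μ : Fin d} (hx : x ∈ blockSites L y)
    (hx' : x + Pi.single μ 1 ∉ blockSites L y) :
    ‖((U (x, μ) : 𝔸ˣ) : 𝔸) - (V (y, μ) : 𝔸)‖ ≤ 62 * ((d : ℝ) * L) ^ 3 * ε₀ := by
  have hN := one_le_dL hL hd
  obtain ⟨h44, hgf, hV⟩ := hmem
  have hU1 : ∀ b, ‖((U b : 𝔸ˣ) : 𝔸)‖ ≤ 1 := fun b => (mem_U1.mp (hU b)).1
  have hU1' : ∀ b, ‖(((U b)⁻¹ : 𝔸ˣ) : 𝔸)‖ ≤ 1 := fun b => (mem_U1.mp (hU b)).2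
  -- in-block bonds of every block
  have hβ : ∀ (y : Fin d → ℤ) (b : ZdEdge d), b.1 ∈ blockSites L y → b.1 + Pi.single b.2 1 ∈ blockSites L y →
      ‖((U b : 𝔸ˣ) : 𝔸) - 1‖ ≤ 11 * ((d : ℝ) * L) ^ 2 * ε₀ := fun y b hb hb' =>
    norm_sub_one_le_of_mem_inBlock hL hd hε₀ hsm hU ⟨h44, hgf, hV⟩ hb hb'
  have hβ0 : 0 ≤ 11 * ((d : ℝ) * L) ^ 2 * ε₀ := by positivity
  -- the axis bond of `c = ⟨y, y + e_μ⟩`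
  have hω : omegaA d L ε₀ ≤ 1 / 10 := by unfold omegaA; linarith
  have haxis := norm_axisBond_sub_le hL U hU V (y, μ) (omegaA_nonneg d L hε₀) hω hβ0
    (fun x hx => norm_loopW_Tavg_sub_one_le hL hd U hU1 hU1' hε₀ hsm h44 (y, μ) x hx) (hβ y) (hV (y, μ))
  -- the ladder from the axis bond to `⟨x, x + e_μ⟩`
  have hcross := norm_crossing_sub_axisBond_le hL U hU hε₀ hβ0 h44 hβ hx hx'
  have hL1 : (L : ℝ) - 1 ≤ (d : ℝ) * L := by
    have h1 : (1 : ℝ) ≤ d := by exact_mod_cast hd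
    have h2 : (0 : ℝ) ≤ L := by positivity
    nlinarith
  set N := (d : ℝ) * L with hNdef
  have hN2 : N ≤ N ^ 2 := by nlinarith
  have hN3 : N ^ 2 ≤ N ^ 3 := by nlinarith
  have hN0 : 0 ≤ N := by linarith
  calc ‖((U (x, μ) : 𝔸ˣ) : 𝔸) - (V (y, μ) : 𝔸)‖
      ≤ ‖((U (x, μ) : 𝔸ˣ) : 𝔸) - ((U (b0Z L (y, μ)) : 𝔸ˣ) : 𝔸)‖
        + ‖((U (b0Z L (y, μ)) : 𝔸ˣ) : 𝔸) - (V (y, μ) : 𝔸)‖ := norm_sub_le_norm_sub_add_norm_sub _ _ _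
    _ ≤ N * (ε₀ + 2 * (11 * N ^ 2 * ε₀))
        + (ε₀ + 12 / 5 * omegaA d L ε₀ + 5 / 4 * (((L : ℝ) - 1) * (11 * N ^ 2 * ε₀))) := add_le_add hcross haxis
    _ ≤ N * (ε₀ + 2 * (11 * N ^ 2 * ε₀))
        + (ε₀ + 12 / 5 * (10 * N ^ 2 * ε₀) + 5 / 4 * (N * (11 * N ^ 2 * ε₀))) := by
        unfold omegaA
        gcongr
    _ = (1 + N + 24 * N ^ 2 + 143 / 4 * N ^ 3) * ε₀ := by ring
    _ ≤ 62 * N ^ 3 * ε₀ := by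
        refine mul_le_mul_of_nonneg_right ?_ hε₀
        have h1 : (1 : ℝ) ≤ N ^ 3 := by nlinarith
        have h2 : N ≤ N ^ 3 := hN2.trans hN3
        linarith

/-- **[Balaban1987RG1] p. 255, THE SENTENCE AFTER (0.16), PROVED**: «fix a configuration U₀ in this region, then
configurations U from this region satisfy |U − U₀| < O(1)ε₀ on T, with an absolute constant O(1)» — for two
`U1`-valued configurations `U, U₀` of the small field region attached to the same coarse configuration `V`
(plaquette regularity `‖·(∂p) − 1‖ ≤ ε₀` on `ℤᵈ`, the (0.16) restrictions `‖𝐔(y,x) − 1‖ ≤ ε₀`, and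
`‖Ū(c) − V(c)‖ ≤ ε₀` on the coarse bonds), EVERY bond variable satisfies `‖U(b) − U₀(b)‖ ≤ 128·(dL)³·ε₀`, provided
`(dL)²ε₀ ≤ 1/100` and `d ≥ 1`; the cell's `O(1) = 128(dL)³` depends on `d` and on the fixed scale factor `L` only.
[cite: Balaban1987RG1, p.255] -/
theorem norm_sub_le_of_mem_smallFieldRegion (hL : 0 < L) (hd : 1 ≤ d) {ε₀ : ℝ} (hε₀ : 0 ≤ ε₀)
    (hsm : ((d : ℝ) * L) ^ 2 * ε₀ ≤ 1 / 100) {V U U₀ : ZdEdge d → 𝔸ˣ} (hU : ∀ b, U b ∈ U1 𝔸)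
    (hU₀ : ∀ b, U₀ b ∈ U1 𝔸) (hmem : U ∈ smallFieldRegion L ε₀ V) (hmem₀ : U₀ ∈ smallFieldRegion L ε₀ V)
    (b : ZdEdge d) :
    ‖((U b : 𝔸ˣ) : 𝔸) - ((U₀ b : 𝔸ˣ) : 𝔸)‖ ≤ 128 * ((d : ℝ) * L) ^ 3 * ε₀ := by
  haveI : NeZero L := ⟨hL.ne'⟩
  have hN := one_le_dL hL hd
  set y := blockMap L b.1 with hy
  have hb : b.1 ∈ blockSites L y := (mem_blockSites_iff L y b.1).2 rfl
  by_cases hb' : b.1 + Pi.single b.2 1 ∈ blockSites L y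
  · -- in-block bond: both within `11(dL)²ε₀` of `1`
    have h1 := norm_sub_one_le_of_mem_inBlock hL hd hε₀ hsm hU hmem hb hb'
    have h2 := norm_sub_one_le_of_mem_inBlock hL hd hε₀ hsm hU₀ hmem₀ hb hb'
    calc ‖((U b : 𝔸ˣ) : 𝔸) - ((U₀ b : 𝔸ˣ) : 𝔸)‖
        ≤ ‖((U b : 𝔸ˣ) : 𝔸) - 1‖ + ‖((U₀ b : 𝔸ˣ) : 𝔸) - 1‖ := by
          rw [← norm_neg (((U₀ b : 𝔸ˣ) : 𝔸) - 1), neg_sub]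
          exact norm_sub_le_norm_sub_add_norm_sub _ _ _
      _ ≤ 11 * ((d : ℝ) * L) ^ 2 * ε₀ + 11 * ((d : ℝ) * L) ^ 2 * ε₀ := add_le_add h1 h2
      _ ≤ 128 * ((d : ℝ) * L) ^ 3 * ε₀ := by
          have : ((d : ℝ) * L) ^ 2 ≤ ((d : ℝ) * L) ^ 3 := by nlinarith
          nlinarith
  · -- crossing bond: both within `62(dL)³ε₀` of `V(c)`
    obtain ⟨x, μ⟩ := b
    have h1 := norm_sub_coarse_le_of_mem_crossing hL hd hε₀ hsm hU hmem hb hb'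
    have h2 := norm_sub_coarse_le_of_mem_crossing hL hd hε₀ hsm hU₀ hmem₀ hb hb'
    calc ‖((U (x, μ) : 𝔸ˣ) : 𝔸) - ((U₀ (x, μ) : 𝔸ˣ) : 𝔸)‖
        ≤ ‖((U (x, μ) : 𝔸ˣ) : 𝔸) - (V (y, μ) : 𝔸)‖ + ‖((U₀ (x, μ) : 𝔸ˣ) : 𝔸) - (V (y, μ) : 𝔸)‖ := by
          rw [← norm_neg (((U₀ (x, μ) : 𝔸ˣ) : 𝔸) - _), neg_sub]
          exact norm_sub_le_norm_sub_add_norm_sub _ _ _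
      _ ≤ 62 * ((d : ℝ) * L) ^ 3 * ε₀ + 62 * ((d : ℝ) * L) ^ 3 * ε₀ := add_le_add h1 h2
      _ ≤ 128 * ((d : ℝ) * L) ^ 3 * ε₀ := by
          have : 0 ≤ ((d : ℝ) * L) ^ 3 * ε₀ := by positivity
          nlinarith

end Main

/-! ## § 7  Non-vacuity: the flat configuration belongs to the region of `V ≡ 1`; the `δ`-function case `Ū = V` -/

section NonVacuity

variable {𝔸 : Type*} [NormedRing 𝔸] [NormedAlgebra ℂ 𝔸] [NormOneClass 𝔸] [CompleteSpace 𝔸] {L : ℕ}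

omit [NormedAlgebra ℂ 𝔸] [NormOneClass 𝔸] [CompleteSpace 𝔸] in
/-- [folklore] the trivial configuration transports trivially along every word. -/
private theorem hol_constOne : ∀ (x : Fin d → ℤ) (w : List (Letter d)),
    hol (Function.curry (1 : ZdEdge d → 𝔸ˣ)) x w = 1
  | _, [] => rfl
  | x, l :: w => by
    rw [hol_cons, hol_constOne (x + l.vec) w, mul_one]
    unfold stepHol
    split_ifs <;> simp

omit [NormOneClass 𝔸] in
/-- [cite: Balaban1987RG1, (0.11) p.253] at the flat configuration every averaged contour variable (0.11) is `1`
(the mean of a constant family, `B12ContourAverage253.fedAvg_const`). -/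
theorem Tavg_constOne (x : Fin d → ℤ) : Tavg L (1 : ZdEdge d → 𝔸ˣ) x = 1 := by
  unfold Tavg B12ContourAverage253.permT
  simp only [hol_constOne]
  exact B12ContourAverage253.fedAvg_const _ _

omit [NormOneClass 𝔸] in
/-- [cite: Balaban1987RG1, (0.12) p.254] at the flat configuration the average (0.12) is `1`. -/
theorem avgBar_constOne (hL : 0 < L) (c : ZdEdge d) : avgBar L (1 : ZdEdge d → 𝔸ˣ) c = 1 := by
  rw [avgBar_eq hL]
  have hY : Yexp L (fun U : ZdEdge d → 𝔸ˣ => Tavg L U) (1 : ZdEdge d → 𝔸ˣ) c = 0 := by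
    unfold Yexp
    refine sum_eq_zero fun x _ => ?_
    rw [B12AverageCorridor267.loopW_def]
    simp only [Tavg_constOne, B12AverageCorridor267.lineR_constOne, Ustr, inv_one, mul_one, Units.val_one,
      mlog_one, smul_zero]
  rw [hY, B12AverageCorridor267.expU_zero, one_mul]
  unfold gcorner
  rw [B12AverageCorridor267.lineR_constOne, one_mul, Pi.one_apply]

/-- **NON-VACUITY**: for every `ε₀ ≥ 0` the flat configuration `U ≡ 1` lies in the small field region attached to
`V ≡ 1` (and is `U1`-valued), so the hypotheses of `norm_sub_le_of_mem_smallFieldRegion` are jointly satisfiable.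
[cite: Balaban1987RG1, p.255] -/
theorem one_mem_smallFieldRegion (hL : 0 < L) {ε₀ : ℝ} (hε₀ : 0 ≤ ε₀) :
    (1 : ZdEdge d → 𝔸ˣ) ∈ smallFieldRegion L ε₀ (1 : ZdEdge d → 𝔸ˣ) ∧ ∀ b, (1 : ZdEdge d → 𝔸ˣ) b ∈ U1 𝔸 := by
  refine ⟨⟨fun p i j _ => ?_, fun y x _ _ => ?_, fun c => ?_⟩, fun b => (U1 𝔸).one_mem⟩
  · simp only [plaquetteHolonomyZd, Pi.one_apply, inv_one, mul_one, Units.val_one, sub_self, norm_zero]; exact hε₀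
  · rw [Tavg_constOne, Units.val_one, sub_self, norm_zero]; exact hε₀
  · rw [avgBar_constOne hL, Pi.one_apply, sub_self, norm_zero]; exact hε₀

omit [NormOneClass 𝔸] in
/-- **THE `δ`-FUNCTION CASE** «the equalities Ū = V in the definitions of [9,16]» (p. 254): a configuration with
`ε₀`-regular plaquettes, the (0.16) restrictions and `Ū = V` EXACTLY lies in the region of `V` (for `ε₀ ≥ 0`).
[cite: Balaban1987RG1, p.254] -/
theorem mem_smallFieldRegion_of_avgBar_eq {ε₀ : ℝ} (hε₀ : 0 ≤ ε₀) {V U : ZdEdge d → 𝔸ˣ}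
    (h44 : ∀ (p : Fin d → ℤ) (i j : Fin d), i ≠ j → ‖((plaquetteHolonomyZd U p i j : 𝔸ˣ) : 𝔸) - 1‖ ≤ ε₀)
    (hgf : ∀ (y x : Fin d → ℤ), x ∈ blockSites L y → x ≠ blockBase L y → ‖((Tavg L U x : 𝔸ˣ) : 𝔸) - 1‖ ≤ ε₀)
    (hδ : ∀ c, avgBar L U c = V c) : U ∈ smallFieldRegion L ε₀ V :=
  ⟨h44, hgf, fun c => by rw [hδ c, sub_self, norm_zero]; exact hε₀⟩

end NonVacuity

end Literature.MathematicalPhysics.QuantumFieldTheory.Balaban1983to89.B12SmallFieldRegion255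

end
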